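import Mathlib
import Literature.MathematicalPhysics.QuantumFieldTheory.Balaban1983to89.B6Geometry

/-!
# `Balaban1983to89.B6LevelGapMetric` — [Balaban1984PropagatorsII] Sect. A pp. 224, 231, 233, 234: the walk-count
hypothesis `B6Geometry.LevelGap N` (the "walk form" of condition (2.2)/(2.57)) KERNEL-DERIVED from hypotheses of the
PRINTED metric shape — a bond-length bound (p. 231) and the separation condition (2.2) read on lattice points — by the
triangle inequality of the ambient (pseudo)metric of T_η; hence (2.60) of Lemma 2.1 from (2.2)-shaped data.  v1.1 (same
unit, append-only §4): the SET-LEVEL form of (2.2) with the partition (2.3)–(2.4), equivalent to the lattice-point form.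

CITATION HEADER (lean-in-tree rule 2026-08-18).  Source: T. Bałaban, *Propagators and renormalization transformations for
lattice gauge theories. II*, Commun. Math. Phys. **96**, 223–250 (1984), doi:10.1007/bf01240221 (cell paper B6; held:
`paper:balaban1984-cmp96-propagators-rt-ii`; journal page = PDF page + 222; the quotations below were read from the page
renders pp. 224, 231, 233 [PDF 2, 9, 11], `b2b-balaban-ref1/pages/1984-cmp96-propagators-rt-II/…-p002, p009, p011-x2.png`).
Companion of the sibling module `…Balaban1983to89.B6Geometry` (pv08 gen 2: zoned graphs of admissible bonds, `LevelGap`,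
`levelGap_dist`, `RealizedBy.exp_le_260`, `ineq260_of_levelGap`, `lemma21Printed_of_ineq261`), which is IMPORTED and NOT
modified; this file discharges its located input (β) (cell GAPS.md G-pv08g2-1: *"`LevelGap N` is the walk form of the
metric condition (2.2)/(2.57) — deriving it from (L^jη)^{−1} dist(Ω_j^c, Ω_{j+1}) > RM needs the embedding of T_η in ℝ^d
and |bond| = L^jη"*) — WITHOUT an embedding in ℝ^d: any pseudo-metric space carrying the lattice points will do.

THE PRINTED INPUTS (verbatim).  p. 224 [2], condition (2.2): *"Ω_j = B^j(Ω_j^{(j)}), Ω_j^{(j)} ⊂ T^{(j)}_{L^jη} and it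
is a sum of big blocks, (L^jη)^{−1} dist(Ω_j^c, Ω_{j+1}) > RM, M is a size of big blocks and R is a big positive integer
which will be fixed later. (2.2)"*.  p. 231 [9]: *"For an arbitrary contour Γ on the lattice T_η we put |Γ| = nη, where
n is a number of bonds the contour Γ consists of."*; *"We consider a special class of contours Γ. They have the property
that a part of Γ contained in B^j(Λ_j) consists of bonds of the lattice Λ_j."*; *"The surface Σ_j separates the sets
B^j(Λ_j) and B^{j−1}(Λ_{j−1})."*  p. 233 [11]: *"From the condition (2.2) and from the definition of the points y′_l,
y_{l+1}, more exactly from the fact that they belong to different surfaces Σ_j, we have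
(L^{j_{l,l+1}}η)^{−1}|y′_l − y_{l+1}| > RM. (2.57)"*.

THE DICTIONARY (ours, as in the sibling's §1–§2).  Vertices `V` = the lattice points that admissible contours visit,
`G` = the graph of admissible bonds, `zone x = j` iff x ∈ B^j(Λ_j) (points of the surfaces Σ_j assigned by the sibling's
closed-Ω convention, so that a Λ_j-bond has both end-points of zone ≥ j), `pos : V → X` = the position of a lattice
point in the torus T_η (any `PseudoMetricSpace X` will do), `ℓ j` = L^jη = the T_η-length of a bond of the lattice Λ_j
(`Monotone ℓ` because L ≥ 1), threshold `T` = RM.  The two printed facts then read: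
* (len) `BondScale G zone pos ℓ`: an admissible bond {u, v} has T_η-length ≤ ℓ (min (zone u) (zone v)) — p. 231: the
  bond lies in some B^j(Λ_j), is a Λ_j-bond of length L^jη = ℓ j, and j ≤ min (zone u) (zone v), so ℓ j ≤ ℓ (min …);
* (sep) `ZoneSep zone pos ℓ T`: if zone u < i < zone x then T · ℓ i < dist (pos u) (pos x) — by (2.3)–(2.4) a point of
  zone < i lies in Ω_i^c and a point of zone > i lies in Ω_{i+1}, so (2.2) gives
  dist (pos u) (pos x) ≥ dist(Ω_i^c, Ω_{i+1}) > RM · L^iη = T · ℓ i.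

WHAT IS PROVED (kernel, no `sorry`, axioms = the three standard ones).
1. `dist_le_length_mul` — along a walk whose bonds all have length ≤ c, the end-points are ≤ (number of bonds)·c apart
   (triangle inequality; this is the step *"|Γ_{y′_l,y_{l+1}}| ≥ |y′_l − y_{l+1}|"* of (2.48), p. 232).
2. `exists_crossing_prefix` — a walk from a point of zone ≤ i to a point of zone > i has an initial segment ending at a
   point of zone > i all of whose bonds have an end-point of zone ≤ i (first entry into Ω_{i+1}; cf. the first
   intersection points y_l of p. 231).
3. `levelGap_of_metric` — (len) + (sep) + `Monotone ℓ` + N ≤ T  ⇒  `B6Geometry.LevelGap G zone N`: every chain of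
   admissible bonds from zone < i to zone > i has at least N + 1 bonds.  (Proof: the prefix of 2. has m bonds, each of
   length ≤ ℓ i by (len) and monotonicity, so T·ℓ i < |pos u − pos b| ≤ m·ℓ i, whence m > T ≥ N; the degenerate sign
   cases ℓ i ≤ 0 are contradictory.)  No positivity of ℓ, no `Separates`, no connectedness is needed.
4. The sibling's (2.60)-theorems with `LevelGap` replaced by the printed-shape data: `RealizedBy.exp_le_260_of_metric`
   (carrier-free), and over a `ContourSystem g` with ℓ j = g.L^j·g.eta, T = g.R·g.M: `levelGap_of_cond22`,
   `ineq260_of_cond22` (= `B6RandomWalk.Ineq260 g δ₀ α`, i.e. (2.60) verbatim, for RM = N ∈ ℕ — R *"a big positive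
   integer"*, M the integer size of big blocks), `lemma21Printed_of_ineq261_cond22` (the sibling's "Lemma 2.1 from
   (2.61) alone" with its geometric hypothesis in printed shape).
5. NON-VACUITY: a finite model (`model_*`: the path 0–1–2–3 with zones 0,1,1,2 on the real line, ℓ ≡ 1, T = N = 2) in
   which (len) and (sep) hold and the conclusion is the non-trivial `3 ≤ p.length` for every walk from 0 to 3.
6. (v1.1, §4, append-only) THE SET-LEVEL FORM OF (2.2): with the nested domains Ω_j ⊂ V of (2.1) tied to the zones by
   (2.3)–(2.4) (`ZonesOf Ω zone`: x ∈ Ω_j ↔ j ≤ zone x, i.e. Ω_j = ⋃_{j′ ≥ j} B^{j′}(Λ_{j′})), the verbatim-shape condition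
   `SetSep Ω pos ℓ T` (*every point of Ω_j^c and every point of Ω_{j+1} are more than T·ℓ j apart* — (2.2) with
   T = RM, ℓ j = L^jη, for sets of lattice points) is EQUIVALENT to (sep) (`setSep_iff_zoneSep`); hence
   `levelGap_of_setSep`, `ineq260_of_setSep22` ((2.60) from (2.1)–(2.4)-shaped data), and the model's domains
   (`model_zonesOf`, `model_setSep`).

WHAT IS NOT PROVED / NOT CLAIMED.  Nothing printed is asserted: (2.2) itself is a HYPOTHESIS on the domains {Ω_j} (it
enters as `ZoneSep`/`Cond22`), and the two dictionary sentences (len), (sep) above are the reading of p. 224/p. 231, not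
theorems about Bałaban's cubes — the set-theoretic bookkeeping "zone < i ⇒ x ∈ Ω_i^c, zone > i ⇒ x ∈ Ω_{i+1}" from
(2.3)–(2.4) is where a future formalisation of the block geometry would plug in.  (2.61) (the lattice-point count
(2.58)), Prop. 2.2 and everything analytic remain as in the siblings (hypotheses there).  G-pv08-1 ((2.66)) untouched.
VALUE: bookkeeping — one unprinted walk-count hypothesis of the B6 chain replaced by two hypotheses of the printed
metric shape; NOT progress on any disputed estimate.
-/

namespace Literature.MathematicalPhysics.QuantumFieldTheory.Balaban1983to89.B6LevelGapMetric

open B6Geometry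

/-! ## 1. Zoned graphs with positions in a pseudo-metric space -/

section Zoned

variable {V : Type*} {G : SimpleGraph V} {zone : V → ℕ} {X : Type*} [PseudoMetricSpace X]
  {pos : V → X} {ℓ : ℕ → ℝ}

/-- (len) p. 231 [9] *"a part of Γ contained in B^j(Λ_j) consists of bonds of the lattice Λ_j"* (a Λ_j-bond has
T_η-length L^jη = ℓ j, and its end-points have zones ≥ j), metric form: an admissible bond {u, v} has length at most
ℓ (min (zone u) (zone v)). [cite: Balaban1984PropagatorsII, p.231] -/
def BondScale (G : SimpleGraph V) (zone : V → ℕ) (pos : V → X) (ℓ : ℕ → ℝ) : Prop :=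
  ∀ ⦃u v : V⦄, G.Adj u v → dist (pos u) (pos v) ≤ ℓ (min (zone u) (zone v))

/-- (sep) condition (2.2) p. 224 [2] *"(L^jη)^{−1} dist(Ω_j^c, Ω_{j+1}) > RM"* read on lattice points (a point of
zone < i lies in Ω_i^c, a point of zone > i lies in Ω_{i+1}, by (2.3)–(2.4)), with threshold T (= RM) and scale ℓ i
(= L^iη): T · ℓ i < |pos u − pos x|. [cite: Balaban1984PropagatorsII, (2.2) p.224 + (2.57) p.233] -/
def ZoneSep (zone : V → ℕ) (pos : V → X) (ℓ : ℕ → ℝ) (T : ℝ) : Prop :=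
  ∀ ⦃i : ℕ⦄ ⦃u x : V⦄, zone u < i → i < zone x → T * ℓ i < dist (pos u) (pos x)

/-- The step *"|Γ_{y′_l,y_{l+1}}| ≥ |y′_l − y_{l+1}|"* of (2.48) p. 232 [10], abstract: if every bond of a walk has
length ≤ c in the ambient pseudo-metric, its end-points are at most (number of bonds)·c apart (triangle inequality). [folklore] -/
theorem dist_le_length_mul (pos : V → X) (c : ℝ) :
    ∀ {a b : V} (q : G.Walk a b), (∀ d ∈ q.darts, dist (pos d.fst) (pos d.snd) ≤ c) →
      dist (pos a) (pos b) ≤ (q.length : ℝ) * c := by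
  intro a b q
  induction q with
  | nil => intro _; simp
  | @cons a b e h q ih =>
    intro hd
    have h1 : dist (pos a) (pos b) ≤ c := hd ⟨(a, b), h⟩ (by simp [SimpleGraph.Walk.darts_cons])
    have h2 : dist (pos b) (pos e) ≤ (q.length : ℝ) * c :=
      ih (fun d hd' => hd d (by rw [SimpleGraph.Walk.darts_cons]; exact List.mem_cons_of_mem _ hd'))
    calc dist (pos a) (pos e) ≤ dist (pos a) (pos b) + dist (pos b) (pos e) := dist_triangle _ _ _
      _ ≤ c + (q.length : ℝ) * c := add_le_add h1 h2
      _ = ((SimpleGraph.Walk.cons h q).length : ℝ) * c := by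
          rw [SimpleGraph.Walk.length_cons]; push_cast; ring

/-- First entry (cf. the first intersection points y₁, y′₁ of p. 231 [9]): a walk from a point of zone ≤ i to a point of
zone > i has an initial segment, ending at a point of zone > i, every bond of which has an end-point of zone ≤ i. [folklore] -/
theorem exists_crossing_prefix (zone : V → ℕ) (i : ℕ) :
    ∀ {v x : V} (p : G.Walk v x), zone v ≤ i → i < zone x →
      ∃ (b : V) (q : G.Walk v b), i < zone b ∧ q.length ≤ p.length ∧
        ∀ d ∈ q.darts, min (zone d.fst) (zone d.snd) ≤ i := by
  intro v x p
  induction p with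
  | nil => intro hv hx; omega
  | @cons a b e h p ih =>
    intro ha he
    by_cases hb : i < zone b
    · refine ⟨b, SimpleGraph.Walk.cons h SimpleGraph.Walk.nil, hb, ?_, ?_⟩
      · simp only [SimpleGraph.Walk.length_cons, SimpleGraph.Walk.length_nil]; omega
      · intro d hd
        rw [SimpleGraph.Walk.darts_cons, SimpleGraph.Walk.darts_nil, List.mem_singleton] at hd
        subst hd
        exact min_le_of_left_le ha
    · obtain ⟨b', q, hb', hq, hd⟩ := ih (not_lt.mp hb) he
      refine ⟨b', SimpleGraph.Walk.cons h q, hb', ?_, ?_⟩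
      · simp only [SimpleGraph.Walk.length_cons]; omega
      · intro d hd'
        rw [SimpleGraph.Walk.darts_cons, List.mem_cons] at hd'
        rcases hd' with rfl | hd'
        · exact min_le_of_left_le ha
        · exact hd d hd'

/-- **The walk form of (2.2) from its metric form.**  (len) `BondScale`, (sep) `ZoneSep … T`, `Monotone ℓ` (L ≥ 1) and
N ≤ T imply `B6Geometry.LevelGap G zone N`: every chain of admissible bonds from a point of zone < i to a point of
zone > i has at least N + 1 bonds — for T = RM this is (2.57) ⇒ "more than RM bonds of the lattice Λ_{j_{l,l+1}}",
the input of the sibling's `levelGap_dist` / (2.60).  No positivity of ℓ, no `Separates`, no connectedness assumed. [cite: Balaban1984PropagatorsII, (2.2) p.224 + p.231 + (2.57) p.233] -/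
theorem levelGap_of_metric {N : ℕ} {T : ℝ} (hmono : Monotone ℓ) (hlen : BondScale G zone pos ℓ)
    (hsep : ZoneSep zone pos ℓ T) (hNT : (N : ℝ) ≤ T) : LevelGap G zone N := by
  intro i u x hu hx p
  obtain ⟨b, q, hb, hq, hd⟩ := exists_crossing_prefix zone i p hu.le hx
  have hD : dist (pos u) (pos b) ≤ (q.length : ℝ) * ℓ i :=
    dist_le_length_mul pos (ℓ i) q (fun d hd' => le_trans (hlen d.adj) (hmono (hd d hd')))
  have hS : T * ℓ i < dist (pos u) (pos b) := hsep hu hb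
  have hne : u ≠ b := by
    rintro rfl
    omega
  have h1 : 1 ≤ q.length := by
    rcases Nat.eq_zero_or_pos q.length with h0 | h0
    · exact absurd (SimpleGraph.Walk.eq_of_length_eq_zero h0) hne
    · exact h0
  have hℓ : 0 < ℓ i := by
    by_contra h
    push Not at h
    have hm0 : (q.length : ℝ) * ℓ i ≤ 0 := mul_nonpos_of_nonneg_of_nonpos (Nat.cast_nonneg _) h
    have hd0 : dist (pos u) (pos b) = 0 := le_antisymm (hD.trans hm0) dist_nonneg
    have hℓ0 : ℓ i < 0 := by
      rcases h.lt_or_eq with h' | h'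
      · exact h'
      · rw [h', mul_zero, hd0] at hS
        exact absurd hS (lt_irrefl 0)
    have h1r : (1 : ℝ) ≤ q.length := by exact_mod_cast h1
    have hneg : (q.length : ℝ) * ℓ i < 0 := mul_neg_of_pos_of_neg (by linarith) hℓ0
    linarith [hD, hd0]
  have hTm : T * ℓ i < (q.length : ℝ) * ℓ i := lt_of_lt_of_le hS hD
  have hTq : T < (q.length : ℝ) := lt_of_mul_lt_mul_right hTm hℓ.le
  have hNq : (N : ℝ) < (q.length : ℝ) := lt_of_le_of_lt hNT hTq
  have hNq' : N < q.length := by exact_mod_cast hNq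
  omega

variable {S : Type*} {d : S → S → ℝ} {ι : S → V}

/-- **(2.60), carrier-free, from printed-shape data**: the sibling's `RealizedBy.exp_le_260` with its walk-count
hypothesis `LevelGap G zone N` supplied by `levelGap_of_metric` — for a distance `d` realised by a connected zoned graph
whose bonds satisfy (len) and whose zones satisfy (sep) with threshold T, and N ∈ ℕ with R·M ≤ N ≤ T (T = RM = N in
print), ε ≥ 0: e^{−ε d(y,y′)} ≤ e^{−ε RM max{|j−j′|−1, 0}}. [cite: Balaban1984PropagatorsII, (2.60) p.234 + (2.2) p.224 + (2.57) p.233] -/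
theorem RealizedBy.exp_le_260_of_metric (h : RealizedBy d G ι) (hconn : G.Connected) {scale : S → ℕ}
    (hzone : ∀ y : S, zone (ι y) = scale y) {N : ℕ} {T : ℝ} (hmono : Monotone ℓ) (hlen : BondScale G zone pos ℓ)
    (hsep : ZoneSep zone pos ℓ T) (hNT : (N : ℝ) ≤ T) {R M ε : ℝ} (hRM : R * M ≤ N) (hε : 0 ≤ ε) (y y' : S) :
    Real.exp (-(ε * d y y')) ≤ Real.exp (-(ε * R * M * max (|(scale y : ℝ) - (scale y' : ℝ)| - 1) 0)) :=
  h.exp_le_260 hconn hzone (levelGap_of_metric hmono hlen hsep hNT) hRM hε y y'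

end Zoned

/-! ## 2. Over a contour system of a `B6.Geometry`: ℓ j = L^jη, T = RM -/

section Contour

variable {g : B6.Geometry} {C : ContourSystem g} {X : Type*} [PseudoMetricSpace X]

/-- (len) for a contour system with lattice-point positions `pos : C.Pt → X` (X = the torus T_η with its metric): an
admissible bond {u, v} has length ≤ L^{min(zone u, zone v)}η — p. 231 [9], a Λ_j-bond has length L^jη. [cite: Balaban1984PropagatorsII, p.231] -/
def BondScale22 (C : ContourSystem g) (pos : C.Pt → X) : Prop :=
  BondScale C.bond C.zone pos (fun j => g.L ^ j * g.eta)

/-- Condition (2.2) p. 224 [2] *"(L^jη)^{−1} dist(Ω_j^c, Ω_{j+1}) > RM"* on the lattice points of a contour system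
(zone < i ⊂ Ω_i^c, zone > i ⊂ Ω_{i+1}): RM · L^iη < |pos u − pos x|. [cite: Balaban1984PropagatorsII, (2.2) p.224] -/
def Cond22 (C : ContourSystem g) (pos : C.Pt → X) : Prop :=
  ZoneSep C.zone pos (fun j => g.L ^ j * g.eta) (g.R * g.M)

/-- The walk form `LevelGap C.bond C.zone N` of (2.2) from (len) + (2.2) on lattice points, for L ≥ 1, η ≥ 0 and any
N ≤ RM. [cite: Balaban1984PropagatorsII, (2.2) p.224 + p.231 + (2.57) p.233] -/
theorem levelGap_of_cond22 (pos : C.Pt → X) (hL : 1 ≤ g.L) (hη : 0 ≤ g.eta) (hlen : BondScale22 C pos)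
    (h22 : Cond22 C pos) {N : ℕ} (hN : (N : ℝ) ≤ g.R * g.M) : LevelGap C.bond C.zone N :=
  levelGap_of_metric (ℓ := fun j => g.L ^ j * g.eta)
    (fun _ _ hab => mul_le_mul_of_nonneg_right (pow_le_pow_right₀ hL hab) hη) hlen h22 hN

/-- **(2.60) from (2.2)-shaped data** (p. 234 [12]: *"e^{−αδ₀d(y,y′)} ≤ e^{−αδ₀RM max{|j−j′|−1,0}}, y ∈ Λ_j, y′ ∈ Λ_{j′},
(2.60)"*): for a geometry whose distance is (2.46) (`Realizes g C`), admissible contours existing (`C.bond.Connected`),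
L ≥ 1, η ≥ 0, the bonds of scale (len) and the lattice points satisfying (2.2) (`Cond22`), and RM = N a natural number
(R *"a big positive integer"*, M the size of big blocks), (2.60) holds for every α, δ₀ with αδ₀ ≥ 0 — the sibling's
`ineq260_of_levelGap` with its hypothesis `LevelGap` DISCHARGED to printed-shape inputs. [cite: Balaban1984PropagatorsII, (2.60) p.234 + (2.2) p.224 + p.231] -/
theorem ineq260_of_cond22 (h : Realizes g C) (hconn : C.bond.Connected) (pos : C.Pt → X) (hL : 1 ≤ g.L)
    (hη : 0 ≤ g.eta) (hlen : BondScale22 C pos) (h22 : Cond22 C pos) {N : ℕ} (hN : (N : ℝ) = g.R * g.M)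
    {δ₀ α : ℝ} (hαδ : 0 ≤ α * δ₀) : B6RandomWalk.Ineq260 g δ₀ α :=
  ineq260_of_levelGap h hconn (levelGap_of_cond22 pos hL hη hlen h22 hN.le) hN.ge hαδ

/-- **Lemma 2.1 from (2.61) alone, geometric inputs in printed shape**: the sibling's `lemma21Printed_of_ineq261` for a
family of geometries, each realised by a contour system with admissible contours existing, L_i ≥ 1, η_i ≥ 0, bonds of
scale (len), lattice points satisfying (2.2), and R_iM_i = N_i ∈ ℕ: `B6.Lemma21Printed` (= (2.60) ∧ (2.61) under
(2.1)–(2.2), 0 < α < 1, (2.59)) follows from (2.61) (`B6RandomWalk.Ineq261`) under the same conditions. [cite: Balaban1984PropagatorsII, Lemma 2.1 p.234 + (2.2) p.224] -/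
theorem lemma21Printed_of_ineq261_cond22 {I : Type} (d : ℕ) (δ₀ : ℝ) (hδ : 0 ≤ δ₀) (geo : I → B6.Geometry)
    (C : ∀ i, ContourSystem (geo i)) (Xi : I → Type*) [∀ i, PseudoMetricSpace (Xi i)]
    (pos : ∀ i, (C i).Pt → Xi i) (N : I → ℕ)
    (hreal : ∀ i, Realizes (geo i) (C i)) (hconn : ∀ i, (C i).bond.Connected)
    (hL : ∀ i, 1 ≤ (geo i).L) (hη : ∀ i, 0 ≤ (geo i).eta)
    (hlen : ∀ i, BondScale22 (C i) (pos i)) (h22 : ∀ i, Cond22 (C i) (pos i))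
    (hN : ∀ i, (N i : ℝ) = (geo i).R * (geo i).M)
    (h261 : ∀ i : I, (geo i).Hyp21_22 → ∀ α : ℝ, 0 < α → α < 1 →
      B6.Cond259 d δ₀ α (geo i).R (geo i).M → B6RandomWalk.Ineq261 d (geo i) δ₀ α) :
    B6.Lemma21Printed d δ₀ geo :=
  lemma21Printed_of_ineq261 d δ₀ hδ geo C N hreal hconn
    (fun i => levelGap_of_cond22 (pos i) (hL i) (hη i) (hlen i) (h22 i) (hN i).le) (fun i => (hN i).ge) h261

end Contour

/-! ## 3. Non-vacuity: a finite model of (len) + (sep) with a non-trivial conclusion -/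

section Model

/-- zones 0, 1, 1, 2 along the path 0 – 1 – 2 – 3 [folklore] -/
def modelZone : Fin 4 → ℕ := fun v => ((v : ℕ) + 1) / 2

/-- positions 0, 1, 2, 3 on the real line [folklore] -/
def modelPos : Fin 4 → ℝ := fun v => ((v : ℕ) : ℝ)

/-- (len) in the model: adjacent points of the path are at distance 1 = ℓ. [folklore] -/
theorem model_bondScale : BondScale (SimpleGraph.pathGraph 4) modelZone modelPos (fun _ => (1 : ℝ)) := by
  intro u v huv
  rw [SimpleGraph.pathGraph_adj] at huv
  fin_cases u <;> fin_cases v <;> simp at huv <;> norm_num [modelPos, Real.dist_eq]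

/-- (sep) in the model with T = 2: the only zone-crossing pair is (0, 3), at distance 3 > 2·1. [folklore] -/
theorem model_zoneSep : ZoneSep modelZone modelPos (fun _ => (1 : ℝ)) 2 := by
  intro i u x hu hx
  fin_cases u <;> fin_cases x <;> simp [modelZone] at hu hx <;> first
    | omega
    | norm_num [modelPos, Real.dist_eq]

/-- The conclusion of `levelGap_of_metric` in the model (N = T = 2). [folklore] -/
theorem model_levelGap : LevelGap (SimpleGraph.pathGraph 4) modelZone 2 :=
  levelGap_of_metric (ℓ := fun _ => (1 : ℝ)) (T := 2) (fun _ _ _ => le_rfl) model_bondScale model_zoneSep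
    (by norm_num)

/-- … which is non-trivial: every walk from 0 (zone 0) to 3 (zone 2) in the path graph has at least 3 bonds. [folklore] -/
theorem model_three_le_length (p : (SimpleGraph.pathGraph 4).Walk 0 3) : 3 ≤ p.length :=
  model_levelGap (i := 1) (by decide) (by decide) p

/-- … and the model graph is connected, so the sibling's `levelGap_dist` applies to it as well (all hypotheses of the
chain (len) + (sep) ⇒ `LevelGap` ⇒ distance bound are jointly satisfiable). [folklore] -/
theorem model_dist_ge : 2 * (modelZone 3 - modelZone 0 - 1) ≤ (SimpleGraph.pathGraph 4).dist 0 3 :=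
  levelGap_dist (SimpleGraph.pathGraph_connected 3) model_levelGap (x := 0) (x' := 3) (by decide)

end Model

/-! ## 4. (v1.1) The set-level form of condition (2.2) with the partition (2.3)–(2.4) -/

section Domains

variable {V : Type*} {X : Type*} [PseudoMetricSpace X] {Ω : ℕ → Set V} {zone : V → ℕ} {pos : V → X}
  {ℓ : ℕ → ℝ} {T : ℝ}

/-- (2.1) + (2.3)–(2.4) p. 224 [2] (*"Ω₁ ⊃ Ω₂ ⊃ … ⊃ Ω_k"*, *"Λ_j = Ω_j^{(j)}∖Ω_{j+1}^{(j)} … Λ₀ = Ω₁^c (2.3)"*,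
*"Ω₁ = ⋃_{j=1}^k B^j(Λ_j), T = ⋃_{j=0}^k B^j(Λ_j), where B⁰(Λ₀) = Λ₀. (2.4)"*), typed: the nested domains as sets of
lattice points, tied to the zone map by x ∈ Ω_j ↔ j ≤ zone x (so Ω_j = ⋃_{j′ ≥ j} B^{j′}(Λ_{j′}), Ω₀ = everything, and
the family is automatically decreasing). [cite: Balaban1984PropagatorsII, (2.1)–(2.4) p.224] -/
def ZonesOf (Ω : ℕ → Set V) (zone : V → ℕ) : Prop :=
  ∀ x j, x ∈ Ω j ↔ j ≤ zone x

/-- Condition (2.2) p. 224 [2] *"(L^jη)^{−1} dist(Ω_j^c, Ω_{j+1}) > RM"* at SET level (for finite sets of lattice points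
the distance of two sets exceeds a bound iff every pair of points does): every point outside Ω_j and every point of
Ω_{j+1} are more than T · ℓ j apart (T = RM, ℓ j = L^jη). [cite: Balaban1984PropagatorsII, (2.2) p.224] -/
def SetSep (Ω : ℕ → Set V) (pos : V → X) (ℓ : ℕ → ℝ) (T : ℝ) : Prop :=
  ∀ ⦃j : ℕ⦄ ⦃u x : V⦄, u ∉ Ω j → x ∈ Ω (j + 1) → T * ℓ j < dist (pos u) (pos x)

/-- The domains of a `ZonesOf` family are nested, (2.1). [cite: Balaban1984PropagatorsII, (2.1) p.224] -/
theorem ZonesOf.antitone (hΩ : ZonesOf Ω zone) : Antitone Ω := by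
  intro j j' hjj' x hx
  rw [hΩ] at hx ⊢
  exact le_trans hjj' hx

/-- Under (2.3)–(2.4) the set-level condition (2.2) IS the lattice-point condition (sep) `ZoneSep`. [cite: Balaban1984PropagatorsII, (2.2)–(2.4) p.224] -/
theorem setSep_iff_zoneSep (hΩ : ZonesOf Ω zone) : SetSep Ω pos ℓ T ↔ ZoneSep zone pos ℓ T := by
  constructor
  · intro h i u x hu hx
    refine h ?_ ?_
    · rw [hΩ u i]; omega
    · rw [hΩ x (i + 1)]; omega
  · intro h j u x hu hx
    rw [hΩ u j] at hu
    rw [hΩ x (j + 1)] at hx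
    exact h (by omega) (by omega)

/-- The walk form `LevelGap N` from (len) + the SET-LEVEL (2.2) + (2.3)–(2.4). [cite: Balaban1984PropagatorsII, (2.1)–(2.4) p.224 + p.231 + (2.57) p.233] -/
theorem levelGap_of_setSep {G : SimpleGraph V} {N : ℕ} (hΩ : ZonesOf Ω zone) (hmono : Monotone ℓ)
    (hlen : BondScale G zone pos ℓ) (hsep : SetSep Ω pos ℓ T) (hNT : (N : ℝ) ≤ T) : LevelGap G zone N :=
  levelGap_of_metric hmono hlen ((setSep_iff_zoneSep hΩ).mp hsep) hNT

variable {g : B6.Geometry} {C : ContourSystem g}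

/-- (2.2) at set level for a contour system: dist(Ω_j^c, Ω_{j+1}) > RM · L^jη on lattice points. [cite: Balaban1984PropagatorsII, (2.2) p.224] -/
def SetSep22 (C : ContourSystem g) (Ω : ℕ → Set C.Pt) (pos : C.Pt → X) : Prop :=
  SetSep Ω pos (fun j => g.L ^ j * g.eta) (g.R * g.M)

/-- `Cond22` from its set-level form. [cite: Balaban1984PropagatorsII, (2.2)–(2.4) p.224] -/
theorem cond22_of_setSep22 {Ω : ℕ → Set C.Pt} {pos : C.Pt → X} (hΩ : ZonesOf Ω C.zone) (h : SetSep22 C Ω pos) :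
    Cond22 C pos :=
  (setSep_iff_zoneSep hΩ).mp h

/-- **(2.60) from (2.1)–(2.4)-shaped data**: `ineq260_of_cond22` with condition (2.2) supplied at SET level (nested
domains Ω_j of lattice points with x ∈ Ω_j ↔ j ≤ zone x, and dist(Ω_j^c, Ω_{j+1}) > RM·L^jη pointwise), bonds of scale
(len), L ≥ 1, η ≥ 0, RM = N ∈ ℕ, αδ₀ ≥ 0. [cite: Balaban1984PropagatorsII, (2.60) p.234 + (2.1)–(2.4) p.224 + p.231] -/
theorem ineq260_of_setSep22 (h : Realizes g C) (hconn : C.bond.Connected) (Ω : ℕ → Set C.Pt) (pos : C.Pt → X)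
    (hΩ : ZonesOf Ω C.zone) (hL : 1 ≤ g.L) (hη : 0 ≤ g.eta) (hlen : BondScale22 C pos) (h22 : SetSep22 C Ω pos)
    {N : ℕ} (hN : (N : ℝ) = g.R * g.M) {δ₀ α : ℝ} (hαδ : 0 ≤ α * δ₀) : B6RandomWalk.Ineq260 g δ₀ α :=
  ineq260_of_cond22 h hconn pos hL hη hlen (cond22_of_setSep22 hΩ h22) hN hαδ

/-- The model's domains Ω_j = {v | j ≤ zone v} (Ω₀ = all four points, Ω₁ = {1,2,3}, Ω₂ = {3}, Ω₃ = ∅). [folklore] -/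
def modelΩ : ℕ → Set (Fin 4) := fun j => {v | j ≤ modelZone v}

/-- (2.3)–(2.4) in the model. [folklore] -/
theorem model_zonesOf : ZonesOf modelΩ modelZone := fun _ _ => Iff.rfl

/-- (2.2) at set level in the model (T = 2, ℓ ≡ 1), via the equivalence with (sep). [folklore] -/
theorem model_setSep : SetSep modelΩ modelPos (fun _ => (1 : ℝ)) 2 :=
  (setSep_iff_zoneSep model_zonesOf).mpr model_zoneSep

end Domains

end Literature.MathematicalPhysics.QuantumFieldTheory.Balaban1983to89.B6LevelGapMetric
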